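import Literature.AlgebraicGeometry.Morphisms.FlatOfFlatFibres
import Mathlib.AlgebraicGeometry.Morphisms.FlatDescent
import Mathlib.RingTheory.RingHom.FaithfullyFlat
import HarnessLib

/-!
# fpqc descent of FLATNESS, and the fibre criterion at a single (geometric) point
# ([StacksProject] §35.23 Tag 02YJ «flat is fpqc local on the base»; [EGAIV3] Thm. 11.3.10)

Topic `Literature/AlgebraicGeometry/Morphisms`, namespace `Literature.AlgebraicGeometry.Morphisms`.  THEOREMS ONLY (no definition, no
named fact, no instance; net Literature debt 0).  Sequel of ★ `Morphisms/FlatOfFlatFibres` (the fibre criterion of flatness over an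
arbitrary base, EGA IV₃ 11.3.10).

At the pin Mathlib provides fpqc descent (`MorphismProperty.DescendsAlong P (@Surjective ⊓ @Flat ⊓ @QuasiCompact)`) for
`LocallyOfFiniteType`, `LocallyOfFinitePresentation`, `Smooth`, `FormallyUnramified`, `Etale` (`Morphisms/LocalFlatDescent`, via
`HasRingHomProperty.descendsAlong_flat` + a `RingHom.*.codescendsAlong_faithfullyFlat` lemma each) and for isomorphisms / open and closed
immersions / … (`Morphisms/FlatDescent`), together with the MODULE-level descent `Module.Flat.of_flat_tensorProduct` («flat descends along
faithfully flat ring maps») — but not the case `P = Flat` itself.  This file supplies it and the working corollaries: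

* §1 `flat_codescendsAlong_faithfullyFlat` — `RingHom.Flat` codescends along faithfully flat ring maps (from Mathlib
  `Module.Flat.of_flat_tensorProduct`); **`flat_descendsAlong`** — `Flat` descends along surjective flat quasi-compact morphisms (fpqc
  descent of flatness, [StacksProject] §35.23; [EGAIV2] Prop. 2.5.1); `flat_of_flat_pullback_snd`, `flat_of_flat_pullback_map_SpecMap`
  (flatness of a morphism may be checked after a faithfully flat quasi-compact base change, e.g. an extension of the base field).
* §2 **`flat_stalkMap_of_flat_pullback_Spec_field`** — the FIBRE CRITERION AT ONE FIELD-VALUED POINT: for `f : X → Y` over `S` (`Y` lft,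
  `X` flat lfp over `S`), `s ∈ S` and ONE morphism `t : Spec K → S` centred at `s` (e.g. a geometric point `Spec Ω → S`) such that the base
  change `X ×_S Spec K → Y ×_S Spec K` is flat, the stalk maps of `f` are flat at all points over `s` — `t` factors through
  `Spec κ(s) → S` (Mathlib `Scheme.descResidueField_stalkClosedPointTo_fromSpecResidueField`), the `K`-fibre is the base change of the
  `κ(s)`-fibre along the surjective flat quasi-compact `Spec K → Spec κ(s)` (★ `isPullback_pullback_map_left_of_comp`), so the `κ(s)`-fibre is
  flat by §1 and ★ `flat_stalkMap_of_flat_fibre_residueField` applies; **`flat_of_forall_exists_flat_pullback_Spec_field`** — `f` is flat as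
  soon as every point of `S` carries SOME field-valued point with flat fibre ([StacksProject] Tag 039E).

Cell `hodgecm-mathlib` (D-0151), SOCKETS-F §3 N4-ét plumbing (geometric-point currency of the cell's abelian-scheme API); prover seat B-p09
(g10).  COUNT-NEUTRAL capital: HC_CM is proved only modulo the 7 printed citations until rung 0 closes; this file discharges none of them.

## References
* [StacksProject] The Stacks Project, §35.23 «Properties of morphisms local in the fpqc topology on the target» (Tag 02YJ), Lemma
  35.23.17 = Tag 02L2 («flat»); Tag 039D–039E (critère de platitude par fibres, Lemma 37.16.4); Tag 00HB (Def. 10.39.1, faithful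
  flatness), Tag 00HJ (Lemma 10.39.8, flatness descends along faithfully flat ring maps).
* [EGAIV2] A. Grothendieck, J. Dieudonné, *EGA IV₂* (1965), Prop. 2.5.1 (p. 22: flatness of `F` relative to `f` descends along a
  faithfully flat `g : Y′ → Y`), Cor. 2.2.13 (i) (p. 13: base change of a faithfully flat morphism is faithfully flat);
  [EGAIV3] *EGA IV₃* (1966), Thm. 11.3.10.
* Tree: ★ `Morphisms/FlatOfFlatFibres` (p737603), ★ `Limits/SurjectiveSpread` (`isPullback_pullback_map_left`).
-/

noncomputable section

-- `TopCat.Presheaf` is not reducible (as in Mathlib's `AlgebraicGeometry/Modules`).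
set_option backward.isDefEq.respectTransparency false

open TensorProduct CategoryTheory CategoryTheory.Limits AlgebraicGeometry

universe u

namespace Literature.AlgebraicGeometry.Morphisms

/-! ## §1 fpqc descent of flatness -/

/-- **`RingHom.Flat` codescends along faithfully flat ring maps**: if `R → S` is faithfully flat and `S → S ⊗_R T` is flat then
`R → T` is flat (Mathlib `Module.Flat.of_flat_tensorProduct`: flatness of modules descends along faithfully flat ring maps).
[cite: StacksProject, Tag 00HJ (Lemma 10.39.8)] [cite: EGAIV2, Prop. 2.5.1] -/
theorem flat_codescendsAlong_faithfullyFlat :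
    RingHom.CodescendsAlong RingHom.Flat RingHom.FaithfullyFlat := by
  refine RingHom.CodescendsAlong.mk _ RingHom.Flat.respectsIso fun R S T _ _ _ _ _ hQ H => ?_
  rw [RingHom.faithfullyFlat_algebraMap_iff] at hQ
  rw [RingHom.flat_algebraMap_iff] at H ⊢
  exact Module.Flat.of_flat_tensorProduct R T S

/-- **fpqc DESCENT OF FLATNESS**: `Flat` descends along surjective flat quasi-compact morphisms — if `g : S' → S` is surjective, flat and
quasi-compact and the base change `X ×_S S' → S'` of `f : X → S` is flat, then `f` is flat ([StacksProject] §35.23 «the property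
"flat" is fpqc local on the base»; Mathlib `HasRingHomProperty.descendsAlong_flat` fed with §1).
[cite: StacksProject, Tag 02L2 (Lemma 35.23.17, §35.23 Tag 02YJ)] [cite: EGAIV2, Prop. 2.5.1] -/
theorem flat_descendsAlong : MorphismProperty.DescendsAlong @Flat (@Surjective ⊓ @Flat ⊓ @QuasiCompact) :=
  HasRingHomProperty.descendsAlong_flat flat_codescendsAlong_faithfullyFlat

/-- **Working form**: for `g : S' → S` surjective, flat and quasi-compact, `Flat (pullback.snd f g) → Flat f`.
[cite: StacksProject, Tag 02L2 (Lemma 35.23.17, §35.23 Tag 02YJ)] -/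
theorem flat_of_flat_pullback_snd {X S S' : Scheme.{u}} (f : X ⟶ S) (g : S' ⟶ S) [Surjective g] [Flat g] [QuasiCompact g]
    [Flat (pullback.snd f g)] : Flat f :=
  haveI := flat_descendsAlong.{u}
  MorphismProperty.of_pullback_snd_of_descendsAlong (P := @Flat) (Q := @Surjective ⊓ @Flat ⊓ @QuasiCompact)
    ⟨⟨‹Surjective g›, ‹Flat g›⟩, ‹QuasiCompact g›⟩ ‹Flat (pullback.snd f g)›

/-- **Working form in `Over` currency**: for `g : S' → S` surjective, flat and quasi-compact and `f : X → Y` over `S`, if the base change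
`X ×_S S' → Y ×_S S'` (`(Over.pullback g).map f`) is flat then `f` is flat (the square over `f` is cartesian, ★
`isPullback_pullback_map_left`; the base-change map `Y ×_S S' → Y` is again surjective flat quasi-compact).
[cite: StacksProject, Tag 02L2 (Lemma 35.23.17, §35.23 Tag 02YJ)] [cite: EGAIV2, Cor. 2.2.13 (i) and Prop. 2.5.1] -/
theorem flat_of_flat_pullback_map {S S' : Scheme.{u}} (g : S' ⟶ S) [Surjective g] [Flat g] [QuasiCompact g] {X Y : Over S}
    (f : X ⟶ Y) [Flat ((Over.pullback g).map f).left] : Flat f.left :=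
  haveI := flat_descendsAlong.{u}
  MorphismProperty.of_isPullback_of_descendsAlong (P := @Flat) (Q := @Surjective ⊓ @Flat ⊓ @QuasiCompact)
    (Literature.AlgebraicGeometry.Limits.isPullback_pullback_map_left g f)
    ⟨⟨MorphismProperty.pullback_fst _ _ ‹Surjective g›, inferInstance⟩, inferInstance⟩ ‹_›

/-- A ring map `κ → K` out of a field into a nonzero ring is faithfully flat, so `Spec K → Spec κ` is surjective and flat (and
affine, hence quasi-compact) — base changes along extensions of the base field are fpqc coverings (Mathlib
`flat_and_surjective_SpecMap_iff`). [cite: StacksProject, Tag 00HB] -/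
theorem surjective_and_flat_SpecMap_of_field {κ : Type u} [Field κ] {K : CommRingCat.{u}} [Nontrivial K]
    (φ : CommRingCat.of κ ⟶ K) : Surjective (Spec.map φ) ∧ Flat (Spec.map φ) := by
  have h : φ.hom.FaithfullyFlat := by
    letI := φ.hom.toAlgebra
    change Module.FaithfullyFlat κ K
    infer_instance
  exact ((flat_and_surjective_SpecMap_iff φ).mpr h).symm

/-- **Flatness may be checked after an extension of the base field**: for `f : X → Y` over `Spec κ` and a ring map `φ : κ → K` into a
nonzero ring (e.g. a field extension), if the base change of `f` along `Spec K → Spec κ` is flat then `f` is flat.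
[cite: StacksProject, Tag 02L2 (Lemma 35.23.17, §35.23 Tag 02YJ)] [cite: EGAIV2, Prop. 2.5.1] -/
theorem flat_of_flat_pullback_map_SpecMap {κ K : Type u} [Field κ] [CommRing K] [Nontrivial K] (φ : κ →+* K)
    {X Y : Over (Spec (CommRingCat.of κ))} (f : X ⟶ Y)
    [Flat ((Over.pullback (Spec.map (CommRingCat.ofHom φ))).map f).left] : Flat f.left := by
  obtain ⟨h₁, h₂⟩ := surjective_and_flat_SpecMap_of_field (CommRingCat.ofHom φ)
  haveI := h₁
  haveI := h₂
  exact flat_of_flat_pullback_map (Spec.map (CommRingCat.ofHom φ)) f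

/-! ## §2 The fibre criterion at ONE field-valued point -/

/-- **The base change along a field-valued point is flat iff the fibre over the residue field is**, «if» direction: for `t : Spec K → S`
(`K` a field) the fibre of `f` over `κ(t(pt))` is flat as soon as the base change of `f` along `t` is — `t = Spec K → Spec κ(t(pt)) → S`
(Mathlib `Scheme.descResidueField_stalkClosedPointTo_fromSpecResidueField`), the `K`-base change is the base change of the `κ`-fibre along
the fpqc covering `Spec K → Spec κ` (★ `isPullback_pullback_map_left_of_comp`), and flatness descends (§1).  (The converse is ★
`flat_pullback_map_of_flat_fibre_residueField`.) [cite: StacksProject, Tag 02L2 (Lemma 35.23.17, §35.23 Tag 02YJ)] [cite: EGAIV3, Thm. 11.3.10] -/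
theorem flat_fibre_residueField_of_flat_pullback_map {S : Scheme.{u}} {X Y : Over S} (f : X ⟶ Y) {K : Type u} [Field K]
    (t : Spec (.of K) ⟶ S) [Flat ((Over.pullback t).map f).left] :
    Flat ((Over.pullback (S.fromSpecResidueField (t (IsLocalRing.closedPoint K)))).map f).left := by
  set s := t (IsLocalRing.closedPoint K) with hs
  let φ : S.residueField s ⟶ CommRingCat.of K := S.descResidueField (Scheme.stalkClosedPointTo t)
  have ht : Spec.map φ ≫ S.fromSpecResidueField s = t := Scheme.descResidueField_stalkClosedPointTo_fromSpecResidueField K S t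
  -- the `K`-base change is the base change of the `κ(s)`-fibre along `Spec K → Spec κ(s)`
  have hK : Flat ((Over.pullback (Spec.map φ ≫ S.fromSpecResidueField s)).map f).left := by
    rw [ht]; infer_instance
  have hsq := isPullback_pullback_map_left_of_comp (Spec.map φ) (S.fromSpecResidueField s) f
  have hY := isPullback_lift_snd_of_comp (Spec.map φ) (S.fromSpecResidueField s) Y
  -- `Spec K → Spec κ(s)` is an fpqc covering, and so is its base change `Y_K → Y_{κ(s)}`
  obtain ⟨h₁, h₂⟩ := surjective_and_flat_SpecMap_of_field (κ := S.residueField s) φ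
  haveI := flat_descendsAlong.{u}
  exact MorphismProperty.of_isPullback_of_descendsAlong (P := @Flat) (Q := @Surjective ⊓ @Flat ⊓ @QuasiCompact) hsq
    ⟨⟨MorphismProperty.of_isPullback (P := @Surjective) hY.flip h₁,
      MorphismProperty.of_isPullback (P := @Flat) hY.flip h₂⟩,
      MorphismProperty.of_isPullback (P := @QuasiCompact) hY.flip inferInstance⟩ hK

/-- **CRITÈRE DE PLATITUDE PAR FIBRES AT ONE FIELD-VALUED (e.g. GEOMETRIC) POINT** ([EGAIV3] Thm. 11.3.10 with fpqc descent along
`Spec K → Spec κ(s)`): for `f : X → Y` over `S` with `Y` locally of finite type and `X` flat and locally of finite presentation over `S`,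
`s ∈ S`, and ONE morphism `t : Spec K → S` (`K` any field) centred at `s` whose base change `X ×_S Spec K → Y ×_S Spec K` is flat, the stalk
map `𝒪_{Y, f x} → 𝒪_{X, x}` is flat at every point `x` of `X` over `s` (`flat_fibre_residueField_of_flat_pullback_map` + ★
`flat_stalkMap_of_flat_fibre_residueField`). [cite: EGAIV3, Thm. 11.3.10] [cite: StacksProject, Tag 02L2 (Lemma 35.23.17, §35.23 Tag 02YJ)] -/
theorem flat_stalkMap_of_flat_pullback_Spec_field {S : Scheme.{u}} {X Y : Over S} (f : X ⟶ Y)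
    [LocallyOfFiniteType Y.hom] [LocallyOfFinitePresentation X.hom] [Flat X.hom] {K : Type u} [Field K]
    (t : Spec (.of K) ⟶ S) [Flat ((Over.pullback t).map f).left] {s : S} (ht : t (IsLocalRing.closedPoint K) = s)
    (x : X.left) (hx : X.hom x = s) : (f.left.stalkMap x).hom.Flat := by
  subst ht
  haveI := flat_fibre_residueField_of_flat_pullback_map f t
  exact flat_stalkMap_of_flat_fibre_residueField f _ x hx

/-- **`f` is flat if every point of the base carries SOME field-valued point with flat fibre** ([StacksProject] Tag 039E with fpqc
descent; `Y` lft, `X` flat lfp over `S`): e.g. all GEOMETRIC fibres `X ×_S Spec Ω → Y ×_S Spec Ω` flat ⇒ `f` flat (Mathlib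
`Flat.of_stalkMap`). [cite: EGAIV3, Thm. 11.3.10] [cite: StacksProject, Tag 02L2 (Lemma 35.23.17, §35.23 Tag 02YJ)] -/
theorem flat_of_forall_exists_flat_pullback_Spec_field {S : Scheme.{u}} {X Y : Over S} (f : X ⟶ Y)
    [LocallyOfFiniteType Y.hom] [LocallyOfFinitePresentation X.hom] [Flat X.hom]
    (hfib : ∀ s : S, ∃ (K : Type u) (_ : Field K) (t : Spec (.of K) ⟶ S),
      t (IsLocalRing.closedPoint K) = s ∧ Flat ((Over.pullback t).map f).left) :
    Flat f.left :=
  Flat.of_stalkMap _ fun x => by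
    obtain ⟨K, _, t, ht, hflat⟩ := hfib (X.hom x)
    exact flat_stalkMap_of_flat_pullback_Spec_field f t ht x rfl

end Literature.AlgebraicGeometry.Morphisms

end
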